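import Summits.ResolutionOfSingularities.ResolutionOfSingularities.Theorems.FrobeniusLadderFInjectiveMacaulayficationT11PlusFedderData
import Summits.ResolutionOfSingularities.ResolutionOfSingularities.Theorems.FrobeniusLadderFInjectiveMacaulayficationPConeOffVertex
import Summits.ResolutionOfSingularities.ResolutionOfSingularities.Theorems.FrobeniusLadderFInjectiveMacaulayficationCIJacobian
import Mathlib.Algebra.MvPolynomial.PDeriv
import HarnessLib

/-!
# `hoff` for `T₁₁⁺`: the crux clause at every closed point of `V(Φ−y²−x³, z²+Φ³+x¹¹+w⁷)` off the stratum `V(x, Φ)`, `p = 7`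
# (crux `FInjectiveMacaulayfication`, K-T4 Lean half, piece (v))

Support file for crux stmt-ResolutionOfSingularities-15315 (`FrobeniusLadder.FInjectiveMacaulayfication`), chain w45a,
seat res-L1-w45a-stub-4 (res-L1-w45a-plan-1 R11.4; object (v) of res-D-pv-018 AS stub-6, 06:59:22Z). [OURS · L1 W4.5a] —
NOT a statement of the manuscript [claim: Hironaka2017]; AI-written, weaker than expert review.

`F₁ = Φ − y² − x³`, `F₂ = z² + Φ³ + x¹¹ + w⁷` in `k[x,y,z,w,Φ] = MvPolynomial (Fin 5) k` (this order), `char k = 7`,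
`X = V(F₁, F₂) ≅ V(T₁₁)` (idea-1's key re-embedding of `T₁₁ = z² + (y²+x³)³ + x¹¹ + w⁷`). MAIN THEOREM
`t11Plus_hoff_char7`: the `hoff` binder of the c.i.-CN engine `CIConeFiModelSmooth.ciConeFiModelRel_of_smoothFaceCertificates`
(p507224) for `Fs = ![F₁, F₂]`, `J = {0, 4}` — at every maximal ideal `Q` of `k[X]/(F₁,F₂)` missing `x̄` or `Φ̄` the local
ring satisfies the per-stalk clause of the crux. Two regimes at the residue point: `x̄ ∉ Q` — Fedder for the complete
intersection (`CIFedderAtMaximalIdeal.ci_fedderAtMaximalIdeal`, stub-6) with the `x`-witness of `…T11PlusFedderData` (this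
covers the far SINGULAR points `x² = 3` of tri-1 F15, where regularity is not available); `x̄ ∈ Q`, `Φ̄ ∉ Q` — then `ȳ ∉ Q`
(`Φ − y² = F₁ + x³ ∈ P`) and the `(y,Φ)`-minor `−6yΦ²` of `∂(F₁,F₂)` is a unit: the CI Jacobian criterion
(`CIJacobian.ci_clause_of_det_not_mem`, stub-6).

* §1 `prime_F₁` (`F₁` linear in `Φ` with coefficient `1`), `F₁_not_dvd_F₂`;
* §2 `ringKrullDim_stalk_add_two` (two cuts, `PConeOffVertex.ringKrullDim_two_cuts`);
* §3 `fedder_at_point_x` (C3a + `T11PlusFedderData.t11Plus_fedder_x`), `clause_of_x_not_mem` (over `Ideal.span s`,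
  `s = {r | r ∈ [F₁,F₂]}`);
* §4 `clause_of_x_mem_P_not_mem` (Jacobian, over `Ideal.span (Set.range Fs)`);
* §5 `t11Plus_hoff_char7` — the binder, over `Ideal.span (Set.range Fs)`, `Fs 0 = F₁`, `Fs 1 = F₂`, as the engine wants.

No definitions, no named facts; glue. [cite: Fedder1983, Prop. 1.7, Thm. 1.12, Prop. 2.1; Matsumura1987, Thm. 30.4 (ii)]
-/

-- single-problem summit: the doubled namespace component is forced
set_option linter.dupNamespace false

noncomputable section

namespace Summit.ResolutionOfSingularities.ResolutionOfSingularities.Theorems.FInjectiveMacaulayfication.T11PlusOffStratum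

open MvPolynomial IsLocalRing Literature.RingTheory.TightClosure Literature.AlgebraicGeometry.Resolution
open Summit.ResolutionOfSingularities.ResolutionOfSingularities.Theorems.FInjectiveMacaulayfication
open ThreefoldG3Prime

/-! ## §1 `F₁` is prime and does not divide `F₂` -/

section Algebra

variable {k : Type} [Field k]

/-- `F₁ = Φ − y² − x³` is prime: linear in `Φ` with unit coefficient (`MvPolynomial.irreducible_mul_X_add`). [folklore] -/
theorem prime_F₁ (F₁ : MvPolynomial (Fin 5) k) (hF₁ : F₁ = X 4 - X 1 ^ 2 - X 0 ^ 3) : Prime F₁ := by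
  have hlin : F₁ = 1 * X 4 + (-(X 1 ^ 2 + X 0 ^ 3)) := by rw [hF₁]; ring
  have h41 : (4 : Fin 5) ≠ 1 := by decide
  have h40 : (4 : Fin 5) ≠ 0 := by decide
  have hvc : (4 : Fin 5) ∉ (-(X 1 ^ 2 + X 0 ^ 3) : MvPolynomial (Fin 5) k).vars := by
    rw [vars_neg]
    exact notMem_vars_add (notMem_vars_pow (notMem_vars_X h41) 2) (notMem_vars_pow (notMem_vars_X h40) 3)
  have hirr : Irreducible F₁ := by
    rw [hlin]
    exact irreducible_mul_X_add _ _ 4 one_ne_zero (by rw [vars_one]; exact Finset.notMem_empty _) hvc isRelPrime_one_left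
  exact UniqueFactorizationMonoid.irreducible_iff_prime.mp hirr

/-- `F₁ ∤ F₂`: at `(0,0,1,0,0)` one has `F₁ = 0`, `F₂ = 1`. [folklore] -/
theorem F₁_not_dvd_F₂ (F₁ F₂ : MvPolynomial (Fin 5) k)
    (hF₁ : F₁ = X 4 - X 1 ^ 2 - X 0 ^ 3) (hF₂ : F₂ = X 2 ^ 2 + X 4 ^ 3 + X 0 ^ 11 + X 3 ^ 7) : ¬ F₁ ∣ F₂ := by
  intro h
  have h1 := map_dvd (MvPolynomial.eval (![0, 0, 1, 0, 0] : Fin 5 → k)) h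
  have ha : MvPolynomial.eval (![0, 0, 1, 0, 0] : Fin 5 → k) F₁ = 0 := by simp [hF₁]
  have hc : MvPolynomial.eval (![0, 0, 1, 0, 0] : Fin 5 → k) F₂ = 1 := by simp [hF₂]
  rw [ha, hc, zero_dvd_iff] at h1
  exact one_ne_zero h1

end Algebra

/-! ## §2 The expected dimension `dim (k[X]/(F₁,F₂))_Q + 2 = 5` -/

section Dimension

variable {k : Type} [Field k]

/-- **The expected-dimension binder** for `T₁₁⁺` (same proof as `PConeOffVertex.ringKrullDim_stalk_add_two`): two cuts in
`k[X]_P`, `F₁` prime, `F₁ ∤ F₂`. [folklore] -/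
theorem ringKrullDim_stalk_add_two (F₁ F₂ : MvPolynomial (Fin 5) k)
    (hF₁ : F₁ = X 4 - X 1 ^ 2 - X 0 ^ 3) (hF₂ : F₂ = X 2 ^ 2 + X 4 ^ 3 + X 0 ^ 11 + X 3 ^ 7)
    (Q : Ideal (MvPolynomial (Fin 5) k ⧸ Ideal.ofList [F₁, F₂])) [Q.IsMaximal] :
    ringKrullDim (Localization.AtPrime Q) + (([F₁, F₂].length : ℕ) : WithBot ℕ∞) = ((5 : ℕ) : WithBot ℕ∞) := by
  haveI hPmax : (Q.comap (Ideal.Quotient.mk (Ideal.ofList [F₁, F₂]))).IsMaximal :=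
    Ideal.comap_isMaximal_of_surjective _ Ideal.Quotient.mk_surjective
  set P : Ideal (MvPolynomial (Fin 5) k) := Q.comap (Ideal.Quotient.mk (Ideal.ofList [F₁, F₂])) with hP
  have hdimR : ringKrullDim (Localization.AtPrime P) = ((5 : ℕ) : WithBot ℕ∞) := by
    rw [IsLocalization.AtPrime.ringKrullDim_eq_height P (Localization.AtPrime P), MvPolynomial.height_eq_of_isMaximal k 5 P]
    norm_cast
  haveI : IsDomain (Localization.AtPrime P) := IsLocalization.isDomain_localization P.primeCompl_le_nonZeroDivisors
  haveI : IsNoetherianRing (Localization.AtPrime P) :=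
    IsLocalization.isNoetherianRing P.primeCompl (Localization.AtPrime P) inferInstance
  have hinj : Function.Injective (algebraMap (MvPolynomial (Fin 5) k) (Localization.AtPrime P)) :=
    IsLocalization.injective (Localization.AtPrime P) P.primeCompl_le_nonZeroDivisors
  have hsub : Ideal.ofList [F₁, F₂] ≤ P := fun r hr => by
    rw [hP, Ideal.mem_comap, Ideal.Quotient.eq_zero_iff_mem.mpr hr]
    exact Q.zero_mem
  have hF₁P : F₁ ∈ P := hsub (Ideal.subset_span (by simp))
  have hF₂P : F₂ ∈ P := hsub (Ideal.subset_span (by simp))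
  have hfm : algebraMap _ (Localization.AtPrime P) F₁ ∈ maximalIdeal (Localization.AtPrime P) ∧
      algebraMap _ (Localization.AtPrime P) F₂ ∈ maximalIdeal (Localization.AtPrime P) := by
    rw [← IsLocalization.AtPrime.map_eq_maximalIdeal P (Localization.AtPrime P)]
    exact ⟨Ideal.mem_map_of_mem _ hF₁P, Ideal.mem_map_of_mem _ hF₂P⟩
  have hprime := prime_F₁ F₁ hF₁
  have hf₁0 : algebraMap _ (Localization.AtPrime P) F₁ ≠ 0 := fun h =>
    hprime.ne_zero (hinj (by rw [map_zero]; exact h))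
  have hspan : Ideal.span {algebraMap _ (Localization.AtPrime P) F₁} =
      (Ideal.span {F₁}).map (algebraMap (MvPolynomial (Fin 5) k) (Localization.AtPrime P)) := by
    rw [Ideal.map_span, Set.image_singleton]
  haveI : (Ideal.span {F₁}).IsPrime := (Ideal.span_singleton_prime hprime.ne_zero).mpr hprime
  have hle : Ideal.span {F₁} ≤ P := (Ideal.span_singleton_le_iff_mem _).mpr hF₁P
  have hp₁ : (Ideal.span {algebraMap _ (Localization.AtPrime P) F₁}).IsPrime := by
    rw [hspan]
    exact Ideal.isPrime_map_of_isLocalizationAtPrime P hle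
  have hnot : algebraMap _ (Localization.AtPrime P) F₂ ∉ Ideal.span {algebraMap _ (Localization.AtPrime P) F₁} := by
    intro h
    rw [hspan, IsLocalization.mem_map_algebraMap_iff P.primeCompl (Localization.AtPrime P)] at h
    obtain ⟨⟨⟨i, hi⟩, ⟨s, hs⟩⟩, h⟩ := h
    dsimp only at h
    rw [← map_mul] at h
    have h' : F₂ * s = i := hinj h
    have hdvd : F₁ ∣ F₂ * s := by
      rw [h']
      exact Ideal.mem_span_singleton.mp hi
    rcases hprime.dvd_or_dvd hdvd with h1 | h1
    · exact F₁_not_dvd_F₂ F₁ F₂ hF₁ hF₂ h1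
    · exact hs (hle (Ideal.mem_span_singleton.mpr h1))
  have hcuts := PConeOffVertex.ringKrullDim_two_cuts _ _ hfm.1 hfm.2 hf₁0 hp₁ hnot
  have hIJ : Ideal.span {algebraMap _ (Localization.AtPrime P) F₁} ⊔ Ideal.span {algebraMap _ (Localization.AtPrime P) F₂} =
      (Ideal.ofList [F₁, F₂]).map (algebraMap (MvPolynomial (Fin 5) k) (Localization.AtPrime P)) := by
    rw [Ideal.map_span, ← Ideal.span_union]
    congr 1
    have hset : {r : MvPolynomial (Fin 5) k | r ∈ [F₁, F₂]} = {F₁, F₂} := by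
      ext r
      simp
    rw [hset, Set.image_insert_eq, Set.image_singleton, Set.singleton_union]
  obtain ⟨e₂⟩ := CIFedderAtMaximalIdeal.nonempty_quotLocalizationEquiv (MvPolynomial (Fin 5) k) (Ideal.ofList [F₁, F₂]) Q
  have hdimQ : ringKrullDim (Localization.AtPrime Q) =
      ringKrullDim (Localization.AtPrime P ⧸ (Ideal.span {algebraMap _ (Localization.AtPrime P) F₁} ⊔
        Ideal.span {algebraMap _ (Localization.AtPrime P) F₂})) := by
    rw [← ringKrullDim_eq_of_ringEquiv e₂, hIJ]
  have h2 : (([F₁, F₂].length : ℕ) : WithBot ℕ∞) = 1 + 1 := by norm_num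
  rw [hdimQ, h2, ← add_assoc, hcuts, hdimR]

end Dimension

/-! ## §3 The Fedder regime `x̄ ∉ Q` -/

section Fedder

variable {k : Type} [Field k] [CharP k 7]

/-- **`(F₁F₂)⁶ ∉ P^[7]` at every maximal ideal `P ⊇ (F₁, F₂)` of `k[X]` with `x ∉ P`** (the residue point has `b_x ≠ 0`;
`T11PlusFedderData.t11Plus_fedder_x` + the residue-point dictionary (C3a)). [cite: Fedder1983, Prop. 1.7 and Prop. 2.1] -/
theorem fedder_at_point_x (F₁ F₂ : MvPolynomial (Fin 5) k)
    (hF₁ : F₁ = X 4 - X 1 ^ 2 - X 0 ^ 3) (hF₂ : F₂ = X 2 ^ 2 + X 4 ^ 3 + X 0 ^ 11 + X 3 ^ 7)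
    (P : Ideal (MvPolynomial (Fin 5) k)) [P.IsMaximal] (hx : (X 0 : MvPolynomial (Fin 5) k) ∉ P) :
    (F₁ * F₂) ^ (7 - 1) ∉ frobeniusPower 7 P := by
  haveI : Fact (Nat.Prime 7) := ⟨by norm_num⟩
  letI : Field (MvPolynomial (Fin 5) k ⧸ P) := Ideal.Quotient.field P
  refine FrobeniusPowerOfFedderAt.frobeniusPower_of_fedderAt 7 k 5 (F₁ * F₂) P ?_
  refine T11PlusFedderData.t11Plus_fedder_x F₁ F₂ hF₁ hF₂ (fun i => Ideal.Quotient.mk P (X i)) ?_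
  exact fun h => hx (Ideal.Quotient.eq_zero_iff_mem.mp h)

/-- **The clause at a closed point with `x̄ ∉ Q`** (Fedder for the complete intersection, stub-6's
`CIFedderAtMaximalIdeal.ci_fedderAtMaximalIdeal`), stated over `Ideal.span s` for any presentation `s = {r | r ∈ [F₁, F₂]}` of
the ideal. [cite: Fedder1983, Prop. 1.7, Thm. 1.12 and Prop. 2.1] -/
theorem clause_of_x_not_mem (F₁ F₂ : MvPolynomial (Fin 5) k)
    (hF₁ : F₁ = X 4 - X 1 ^ 2 - X 0 ^ 3) (hF₂ : F₂ = X 2 ^ 2 + X 4 ^ 3 + X 0 ^ 11 + X 3 ^ 7)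
    (s : Set (MvPolynomial (Fin 5) k)) (hs : s = {r : MvPolynomial (Fin 5) k | r ∈ [F₁, F₂]}) :
    ∀ (Q : Ideal (MvPolynomial (Fin 5) k ⧸ Ideal.span s)) [Q.IsMaximal],
      (X 0 : MvPolynomial (Fin 5) k) ∉ Q.comap (Ideal.Quotient.mk (Ideal.span s)) →
      ∀ d : ℕ, ringKrullDim (Localization.AtPrime Q) = d → ∀ sq : Fin d → Localization.AtPrime Q,
        (Ideal.span (Set.range sq)).radical.IsMaximal →
          RingTheory.Sequence.IsWeaklyRegular (Localization.AtPrime Q) (List.ofFn sq) ∧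
          ∀ y : Localization.AtPrime Q, (∃ e : ℕ, y ^ 7 ^ e ∈ Ideal.span
            ((fun z : Localization.AtPrime Q => z ^ 7 ^ e) ''
              (Ideal.span (Set.range sq) : Set (Localization.AtPrime Q)))) → y ∈ Ideal.span (Set.range sq) := by
  subst hs
  intro Q _ hx
  haveI : Fact (Nat.Prime 7) := ⟨by norm_num⟩
  haveI hPmax : (Q.comap (Ideal.Quotient.mk (Ideal.ofList [F₁, F₂]))).IsMaximal :=
    Ideal.comap_isMaximal_of_surjective _ Ideal.Quotient.mk_surjective
  obtain ⟨m, a, ha⟩ := Submodule.fg_iff_exists_fin_generating_family.mp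
    (IsNoetherian.noetherian (Q.comap (Ideal.Quotient.mk (Ideal.ofList [F₁, F₂]))))
  have hfedP := fedder_at_point_x F₁ F₂ hF₁ hF₂ (Q.comap (Ideal.Quotient.mk (Ideal.ofList [F₁, F₂]))) hx
  have hfed : [F₁, F₂].prod ^ (7 - 1) ∉ Ideal.span (Set.range fun i : Fin m => a i ^ 7) := by
    intro h
    apply hfedP
    have hle : Ideal.span (Set.range fun i : Fin m => a i ^ 7) ≤
        frobeniusPower 7 (Q.comap (Ideal.Quotient.mk (Ideal.ofList [F₁, F₂]))) := by
      rw [Ideal.span_le]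
      rintro _ ⟨i, rfl⟩
      have hai : a i ∈ Q.comap (Ideal.Quotient.mk (Ideal.ofList [F₁, F₂])) := by
        rw [← ha]
        exact Submodule.subset_span ⟨i, rfl⟩
      exact pow_mem_frobeniusPower hai
    have hprod : [F₁, F₂].prod = F₁ * F₂ := by simp
    rw [hprod] at h
    exact hle h
  exact CIFedderAtMaximalIdeal.ci_fedderAtMaximalIdeal k 5 m 7 a [F₁, F₂] Q ha.symm hfed
    (ringKrullDim_stalk_add_two F₁ F₂ hF₁ hF₂ Q)

/-! ## §4 The Jacobian regime `x̄ ∈ Q`, `Φ̄ ∉ Q` -/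

/-- **The clause at a closed point with `x̄ ∈ Q`, `Φ̄ ∉ Q`**: there `ȳ ∉ Q` and the `(y,Φ)`-minor of the Jacobian of
`(F₁, F₂)`, `(−2y)(3Φ²) − 0·1 = −6yΦ²`, is not in `P`; stub-6's `CIJacobian.ci_clause_of_det_not_mem`. Stated for a family
`Fs : Fin 2 → k[X]` with `Fs 0 = F₁`, `Fs 1 = F₂` (the shape of `T11PlusPrime.t11plus_prime_and_X_ne_zero`).
[cite: Matsumura1987, Thm. 30.4 (ii) and Thm. 14.2] -/
theorem clause_of_x_mem_P_not_mem (Fs : Fin 2 → MvPolynomial (Fin 5) k)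
    (hF₀ : Fs 0 = X 4 - X 1 ^ 2 - X 0 ^ 3) (hF₁ : Fs 1 = X 2 ^ 2 + X 4 ^ 3 + X 0 ^ 11 + X 3 ^ 7)
    (Q : Ideal (MvPolynomial (Fin 5) k ⧸ Ideal.span (Set.range Fs))) [Q.IsPrime]
    (hx : (X 0 : MvPolynomial (Fin 5) k) ∈ Q.comap (Ideal.Quotient.mk (Ideal.span (Set.range Fs))))
    (hP : (X 4 : MvPolynomial (Fin 5) k) ∉ Q.comap (Ideal.Quotient.mk (Ideal.span (Set.range Fs)))) :
    ∀ d : ℕ, ringKrullDim (Localization.AtPrime Q) = d → ∀ sq : Fin d → Localization.AtPrime Q,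
      (Ideal.span (Set.range sq)).radical.IsMaximal →
        RingTheory.Sequence.IsWeaklyRegular (Localization.AtPrime Q) (List.ofFn sq) ∧
        ∀ y : Localization.AtPrime Q, (∃ e : ℕ, y ^ 7 ^ e ∈ Ideal.span
          ((fun z : Localization.AtPrime Q => z ^ 7 ^ e) ''
            (Ideal.span (Set.range sq) : Set (Localization.AtPrime Q)))) → y ∈ Ideal.span (Set.range sq) := by
  haveI : Fact (Nat.Prime 7) := ⟨by norm_num⟩
  set P := Q.comap (Ideal.Quotient.mk (Ideal.span (Set.range Fs))) with hPdef
  haveI : P.IsPrime := Ideal.comap_isPrime _ _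
  -- `F₁ ∈ P`, hence `y ∉ P`
  have hF₁P : Fs 0 ∈ P := by
    rw [hPdef, Ideal.mem_comap, Ideal.Quotient.eq_zero_iff_mem.mpr (Ideal.subset_span (Set.mem_range_self 0))]
    exact Q.zero_mem
  have hy : (X 1 : MvPolynomial (Fin 5) k) ∉ P := by
    intro hy
    apply hP
    have h : (X 4 : MvPolynomial (Fin 5) k) = Fs 0 + X 1 * X 1 + X 0 * X 0 ^ 2 := by rw [hF₀]; ring
    rw [h]
    exact add_mem (add_mem hF₁P (Ideal.mul_mem_right _ _ hy)) (Ideal.mul_mem_right _ _ hx)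
  -- the derivations `∂_y`, `∂_Φ` and the minor
  let D : Fin 2 → Derivation ℤ (MvPolynomial (Fin 5) k) (MvPolynomial (Fin 5) k) :=
    ![(pderiv 1).restrictScalars ℤ, (pderiv 4).restrictScalars ℤ]
  have hdet : (Matrix.of fun i j => D i (Fs j)).det = C (-6) * X 1 * X 4 ^ 2 := by
    rw [Matrix.det_fin_two]
    simp only [D, Matrix.of_apply, Matrix.cons_val_zero, Matrix.cons_val_one, Derivation.restrictScalars_apply, hF₀, hF₁,
      map_add, map_sub, Derivation.leibniz_pow, pderiv_X_self, pderiv_X_of_ne (show (4 : Fin 5) ≠ 1 by decide),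
      pderiv_X_of_ne (show (0 : Fin 5) ≠ 1 by decide), pderiv_X_of_ne (show (2 : Fin 5) ≠ 1 by decide),
      pderiv_X_of_ne (show (3 : Fin 5) ≠ 1 by decide), pderiv_X_of_ne (show (1 : Fin 5) ≠ 4 by decide),
      pderiv_X_of_ne (show (0 : Fin 5) ≠ 4 by decide), pderiv_X_of_ne (show (2 : Fin 5) ≠ 4 by decide),
      pderiv_X_of_ne (show (3 : Fin 5) ≠ 4 by decide), smul_eq_mul, mul_one, nsmul_eq_mul, map_neg, map_ofNat]
    norm_num
    ring
  have h6 : (-6 : k) ≠ 0 := by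
    intro h
    have h' : ((6 : ℕ) : k) = 0 := by
      have : (6 : k) = 0 := by linear_combination -h
      exact_mod_cast this
    rw [CharP.cast_eq_zero_iff k 7] at h'
    omega
  have hndet : (Matrix.of fun i j => D i (Fs j)).det ∉ P := by
    rw [hdet]
    intro h
    rcases (Ideal.IsPrime.mem_or_mem ‹P.IsPrime› h) with h1 | h1
    · rcases (Ideal.IsPrime.mem_or_mem ‹P.IsPrime› h1) with h2 | h2
      · exact (Ideal.IsPrime.ne_top ‹P.IsPrime›) (Ideal.eq_top_of_isUnit_mem _ h2 ((isUnit_iff_ne_zero.mpr h6).map C))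
      · exact hy h2
    · exact hP (Ideal.IsPrime.mem_of_pow_mem ‹P.IsPrime› 2 h1)
  exact (CIJacobian.ci_clause_of_det_not_mem 7 k 5 2 Fs Q D hndet).2.2.1

/-! ## §5 The `hoff` binder of the c.i.-CN engine for `T₁₁⁺`, `J = {0, 4}` -/

/-- **`hoff` FOR `T₁₁⁺`, `char k = 7`** — the hypothesis `hoff` of `CIConeFiModelSmooth.ciConeFiModelRel_of_smoothFaceCertificates`
for a family `Fs : Fin 2 → k[x,y,z,w,Φ]` with `Fs 0 = Φ − y² − x³`, `Fs 1 = z² + Φ³ + x¹¹ + w⁷` (the shape of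
`T11PlusPrime.t11plus_prime_and_X_ne_zero`) and `J = {0, 4}`: at every maximal ideal of `k[X]/(Fs)` missing `x̄` or `Φ̄` the
local ring satisfies the per-stalk clause of crux `FInjectiveMacaulayfication`. [cite: Fedder1983, Prop. 2.1; Matsumura1987,
Thm. 30.4 (ii)] -/
theorem t11Plus_hoff_char7 (k : Type) [Field k] [CharP k 7] (Fs : Fin 2 → MvPolynomial (Fin 5) k)
    (hF₀ : Fs 0 = X 4 - X 1 ^ 2 - X 0 ^ 3) (hF₁ : Fs 1 = X 2 ^ 2 + X 4 ^ 3 + X 0 ^ 11 + X 3 ^ 7) :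
    ∀ (Q : Ideal (MvPolynomial (Fin 5) k ⧸ Ideal.span (Set.range Fs))) [Q.IsMaximal],
      (∃ j ∈ ({0, 4} : Finset (Fin 5)), Ideal.Quotient.mk (Ideal.span (Set.range Fs)) (MvPolynomial.X j) ∉ Q) →
      ∀ dd : ℕ, ringKrullDim (Localization.AtPrime Q) = dd → ∀ s : Fin dd → Localization.AtPrime Q,
        (Ideal.span (Set.range s)).radical.IsMaximal →
          RingTheory.Sequence.IsWeaklyRegular (Localization.AtPrime Q) (List.ofFn s) ∧
          ∀ y : Localization.AtPrime Q, (∃ e : ℕ, y ^ 7 ^ e ∈ Ideal.span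
            ((fun z : Localization.AtPrime Q => z ^ 7 ^ e) ''
              (Ideal.span (Set.range s) : Set (Localization.AtPrime Q)))) → y ∈ Ideal.span (Set.range s) := by
  intro Q _ hj
  by_cases hx : (X 0 : MvPolynomial (Fin 5) k) ∈ Q.comap (Ideal.Quotient.mk (Ideal.span (Set.range Fs)))
  · -- then `Φ̄ ∉ Q`
    have hP : (X 4 : MvPolynomial (Fin 5) k) ∉ Q.comap (Ideal.Quotient.mk (Ideal.span (Set.range Fs))) := by
      obtain ⟨j, hj, hjQ⟩ := hj
      simp only [Finset.mem_insert, Finset.mem_singleton] at hj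
      rcases hj with rfl | rfl
      · exact absurd (Ideal.mem_comap.mp hx) hjQ
      · exact fun h => hjQ (Ideal.mem_comap.mp h)
    exact clause_of_x_mem_P_not_mem Fs hF₀ hF₁ Q hx hP
  · have hrange : Set.range Fs = {r : MvPolynomial (Fin 5) k | r ∈ [Fs 0, Fs 1]} := by
      ext r
      simp only [Set.mem_range, Set.mem_setOf_eq, List.mem_cons, List.not_mem_nil, or_false]
      constructor
      · rintro ⟨i, rfl⟩
        fin_cases i <;> simp
      · rintro (h | h)
        · exact ⟨0, h.symm⟩
        · exact ⟨1, h.symm⟩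
    exact clause_of_x_not_mem (Fs 0) (Fs 1) hF₀ hF₁ (Set.range Fs) hrange Q hx

end Fedder

end Summit.ResolutionOfSingularities.ResolutionOfSingularities.Theorems.FInjectiveMacaulayfication.T11PlusOffStratum

end
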